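import Mathlib.LinearAlgebra.SesquilinearForm.Basic
import Mathlib.LinearAlgebra.SesquilinearForm.Orthogonal
import Mathlib.LinearAlgebra.FiniteDimensional.Lemmas
import Mathlib.LinearAlgebra.Dual.Lemmas
import Mathlib.Algebra.Module.Submodule.Invariant
import HarnessLib

/-!
# K2 ∕ E3 «EllipticInputs», unit U12 — helper file for socket #10 `sig_K2E3OrbitClosureContainsSemisimple`:
# hermitian pairs — orthogonal complements, hyperbolic partners of a totally isotropic subspace, and the adapted basis
# `W ⊕ U ⊕ W'` with its coordinate formulas

Cell `hodgecm-mathlib` (Track B «K2-LIT»), item h413 = `stmt-HodgeConjecture-24833`; author K2E3-p10 (g0).  PROOF lane (theorems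
only, no `sorry`); pure linear algebra over Mathlib, for a `σ`-sesquilinear form `h : V →ₛₗ[σ] V →ₗ[K] K` (semilinear in the FIRST
variable, as `h(x, y) = (σ x)ᵀ J y` of ★ `UnitaryGroup.hermForm`) that is HERMITIAN (`h y x = σ (h x y)`, `σ` an involution) and
non-degenerate, over a field with `2 ≠ 0`.  This is the linear algebra behind the non-split half of [HarishChandra1999, §21 p. 87]
(«the closure of a `G`-orbit contains a semisimple element») for the genuine unitary groups `U(σ_w, H_w)(L_w)`:

* §1 orthogonal complements (`Submodule.orthogonalBilin`): symmetry, invariance under an isometry, the dimension bound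
  `dim V ≤ dim W + dim W^⊥`, and the NON-DEGENERATE case `W ⊓ W^⊥ = ⊥ ⇒ V = W ⊕ W^⊥` with `h|_{W^⊥}` non-degenerate;
* §2 the TOTALLY ISOTROPIC case: dual vectors `h(w_i, y_j) = δ_{ij}` (`exists_dual_family`), their isotropic correction
  `w'_j = y_j − ½ Σ_l h(y_l, y_j) w_l` (`exists_hyperbolic_partner`: `h(w_i, w'_j) = δ_{ij}`, `h(w'_i, w'_j) = 0`), and, for
  `U = (W ⊕ W')^⊥` and any basis of `U`, the adapted basis `(w, u, w')` of `V` with the coordinate formulas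
  `(v)_{w_i} = h(w'_i, v)`, `(v)_{w'_i} = h(w_i, v)` (`exists_adapted_basis`).

References: J. Dieudonné, *La géométrie des groupes classiques* (1971), Ch. I §11 (hyperbolic planes); folklore.
-/

set_option autoImplicit false
set_option linter.dupNamespace false

namespace Summit.HodgeConjecture.HodgeConjecture.Cruxes.H413.K2E3OrbitClosureHermitianPairs

open Module Module.End

variable {K : Type*} [Field K] {σ : K →+* K} {V : Type*} [AddCommGroup V] [Module K V]
  (h : V →ₛₗ[σ] V →ₗ[K] K)

/-! ## §1 Orthogonal complements -/

/-- For a hermitian form orthogonality is symmetric. [folklore] -/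
theorem apply_eq_zero_comm (hherm : ∀ x y, h y x = σ (h x y)) {x y : V} : h x y = 0 ↔ h y x = 0 := by
  constructor <;> intro hxy
  · rw [hherm, hxy, map_zero]
  · rw [hherm, hxy, map_zero]

/-- Pairing with a linear combination of a family in the first (semilinear) variable. [folklore] -/
theorem apply_sum_smul_left {ι : Type*} (s : Finset ι) (c : ι → K) (x : ι → V) (y : V) :
    h (∑ i ∈ s, c i • x i) y = ∑ i ∈ s, σ (c i) * h (x i) y := by
  rw [map_sum, LinearMap.sum_apply]
  refine Finset.sum_congr rfl fun i _ => ?_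
  rw [LinearMap.map_smulₛₗ, LinearMap.smul_apply, smul_eq_mul]

/-- Pairing with a linear combination in the second (linear) variable. [folklore] -/
theorem apply_sum_smul_right {ι : Type*} (s : Finset ι) (x : V) (c : ι → K) (y : ι → V) :
    h x (∑ i ∈ s, c i • y i) = ∑ i ∈ s, c i * h x (y i) := by
  rw [map_sum]
  refine Finset.sum_congr rfl fun i _ => ?_
  rw [map_smul, smul_eq_mul]

omit h in
/-- Expansion of an element of `W` in a basis of `W`, read in `V`. [folklore] -/
theorem coe_eq_sum_repr {W : Submodule K V} {ι : Type*} [Fintype ι] (bW : Basis ι K W) (w : W) :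
    (w : V) = ∑ i, bW.repr w i • (bW i : V) := by
  have := congrArg Subtype.val (bW.sum_repr w).symm
  simpa only [Submodule.coe_sum, Submodule.coe_smul] using this

/-- `v` is orthogonal to `W` iff it is orthogonal to a basis of `W`. [folklore] -/
theorem forall_mem_apply_eq_zero_iff {W : Submodule K V} {ι : Type*} [Fintype ι] (bW : Basis ι K W) (v : V) :
    (∀ w ∈ W, h w v = 0) ↔ ∀ i, h (bW i) v = 0 := by
  refine ⟨fun H i => H _ (bW i).2, fun H w hw => ?_⟩
  rw [show w = ((⟨w, hw⟩ : W) : V) from rfl, coe_eq_sum_repr bW ⟨w, hw⟩, apply_sum_smul_left]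
  simp [H]

/-- **The orthogonal complement of an invariant subspace is invariant** under an isometry `g` with `g W = W`. [folklore] -/
theorem orthogonalBilin_mem_invtSubmodule {g : Module.End K V} (hg : ∀ x y, h (g x) (g y) = h x y) {W : Submodule K V}
    (hW : W.map g = W) : W.orthogonalBilin h ∈ g.invtSubmodule := by
  rw [Module.End.mem_invtSubmodule_iff_forall_mem_of_mem]
  intro y hy
  rw [Submodule.mem_orthogonalBilin_iff] at hy ⊢
  intro w hw
  rw [← hW] at hw
  obtain ⟨w', hw', rfl⟩ := Submodule.mem_map.1 hw
  rw [hg]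
  exact hy w' hw'

variable [FiniteDimensional K V]

/-- **Dimension bound**: `dim V ≤ dim W + dim W^⊥` (`W^⊥` is the kernel of `v ↦ (h(w_i, v))_i` for a basis `(w_i)` of `W`). [folklore] -/
theorem finrank_le_finrank_add_finrank_orthogonalBilin (W : Submodule K V) :
    finrank K V ≤ finrank K W + finrank K (W.orthogonalBilin h) := by
  let bW := Module.finBasis K W
  let Φ : V →ₗ[K] (Fin (finrank K W) → K) := LinearMap.pi fun i => h (bW i : V)
  have hker : LinearMap.ker Φ = W.orthogonalBilin h := by
    ext v
    rw [LinearMap.mem_ker, Submodule.mem_orthogonalBilin_iff]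
    simp only [forall_mem_apply_eq_zero_iff h bW v, Φ, funext_iff, LinearMap.pi_apply, Pi.zero_apply]
  have h1 := LinearMap.finrank_range_add_finrank_ker Φ
  have h2 : finrank K (LinearMap.range Φ) ≤ finrank K W :=
    (Submodule.finrank_le _).trans (by rw [Module.finrank_fin_fun])
  rw [hker] at h1
  omega

/-- **Non-degenerate subspaces split off**: if `W ⊓ W^⊥ = ⊥` then `V = W ⊕ W^⊥`. [folklore] -/
theorem isCompl_orthogonalBilin_of_disjoint {W : Submodule K V} (hdis : Disjoint W (W.orthogonalBilin h)) :
    IsCompl W (W.orthogonalBilin h) := by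
  refine ⟨hdis, codisjoint_iff.2 (Submodule.eq_top_of_finrank_eq (le_antisymm (Submodule.finrank_le _) ?_))⟩
  have h1 := Submodule.finrank_sup_add_finrank_inf_eq W (W.orthogonalBilin h)
  rw [hdis.eq_bot, finrank_bot, add_zero] at h1
  rw [h1]
  exact finrank_le_finrank_add_finrank_orthogonalBilin h W

omit [FiniteDimensional K V] in
/-- **`h` restricted to `W^⊥` is non-degenerate** when `V = W + W^⊥` (hermitian `h`). [folklore] -/
theorem nondegenerate_restrict_orthogonalBilin (hherm : ∀ x y, h y x = σ (h x y)) (hnd : ∀ x, (∀ y, h x y = 0) → x = 0)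
    {W : Submodule K V} (htop : W ⊔ W.orthogonalBilin h = ⊤) (x : W.orthogonalBilin h)
    (hx : ∀ y : W.orthogonalBilin h, h x y = 0) : x = 0 := by
  apply Subtype.ext
  refine hnd _ fun v => ?_
  have hv : v ∈ W ⊔ W.orthogonalBilin h := by rw [htop]; exact Submodule.mem_top
  obtain ⟨w, hw, u, hu, rfl⟩ := Submodule.mem_sup.1 hv
  rw [map_add, hx ⟨u, hu⟩, add_zero, apply_eq_zero_comm h hherm]
  exact x.2 w hw

/-! ## §2 Totally isotropic subspaces: hyperbolic partners and the adapted basis -/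

omit [FiniteDimensional K V] in
/-- **Dual vectors**: for a non-degenerate `h` and a basis `(w_i)` of a subspace `W`, there are `y_j ∈ V` with `h(w_i, y_j) = δ_{ij}`
(the functionals `h(w_i, ·)` are linearly independent, so `v ↦ (h(w_i, v))_i` is onto). [folklore] -/
theorem exists_dual_family (hσ : ∀ a, σ (σ a) = a) (hnd : ∀ x, (∀ y, h x y = 0) → x = 0) {W : Submodule K V}
    {ι : Type*} [Fintype ι] [DecidableEq ι] (bW : Basis ι K W) :
    ∃ y : ι → V, ∀ i j, h (bW i) (y j) = if i = j then 1 else 0 := by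
  let Φ : V →ₗ[K] (ι → K) := LinearMap.pi fun i => h (bW i : V)
  have hsurj : Function.Surjective Φ := by
    rw [← LinearMap.range_eq_top]
    by_contra hne
    obtain ⟨f, hf0, hf⟩ := Submodule.exists_dual_map_eq_bot_of_lt_top (lt_top_iff_ne_top.2 hne) inferInstance
    -- `f ∘ Φ = 0`
    have hfΦ : ∀ v, f (Φ v) = 0 := fun v => by
      have : f (Φ v) ∈ (LinearMap.range Φ).map f := Submodule.mem_map_of_mem (LinearMap.mem_range_self Φ v)
      rwa [hf, Submodule.mem_bot] at this
    -- the vector `x = Σ σ(f e_i) w_i` pairs to zero with everything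
    let c : ι → K := fun i => f (Pi.single i 1)
    have hfc : ∀ z : ι → K, f z = ∑ i, z i * c i := fun z => by
      conv_lhs => rw [pi_eq_sum_univ z]
      simp only [map_sum, map_smul, smul_eq_mul, c]
      refine Finset.sum_congr rfl fun i _ => ?_
      congr 2
      funext j
      simp [Pi.single_apply, eq_comm]
    set x : V := ∑ i, σ (c i) • (bW i : V) with hxdef
    have hx : ∀ v, h x v = 0 := fun v => by
      rw [hxdef, apply_sum_smul_left]
      simp only [hσ]
      have := hfΦ v
      rw [hfc] at this
      simpa [Φ, mul_comm] using this
    have hx0 : x = 0 := hnd x hx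
    have hli : LinearIndependent K fun i => (bW i : V) := bW.linearIndependent.map' W.subtype W.ker_subtype
    have hc : ∀ i, c i = 0 := fun i => by
      have := (Fintype.linearIndependent_iff.1 hli (fun i => σ (c i)) hx0) i
      rw [← hσ (c i), this, map_zero]
    apply hf0
    refine LinearMap.ext fun z => ?_
    rw [hfc, LinearMap.zero_apply]
    simp [hc]
  choose y hy using fun j => hsurj (Pi.single j 1)
  refine ⟨y, fun i j => ?_⟩
  have := congrFun (hy j) i
  simpa [Φ, Pi.single_apply] using this

omit [FiniteDimensional K V] in
/-- **Hyperbolic partners of a totally isotropic subspace**: with `2 ≠ 0`, the dual vectors can be corrected to ISOTROPIC ones,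
`w'_j = y_j − ½ Σ_l h(y_l, y_j) w_l`: `h(w_i, w'_j) = δ_{ij}` and `h(w'_i, w'_j) = 0`. [folklore] -/
theorem exists_hyperbolic_partner (hσ : ∀ a, σ (σ a) = a) (h2 : (2 : K) ≠ 0) (hherm : ∀ x y, h y x = σ (h x y))
    (hnd : ∀ x, (∀ y, h x y = 0) → x = 0) {W : Submodule K V} (hWiso : ∀ x ∈ W, ∀ y ∈ W, h x y = 0)
    {ι : Type*} [Fintype ι] [DecidableEq ι] (bW : Basis ι K W) :
    ∃ w' : ι → V, (∀ i j, h (bW i) (w' j) = if i = j then 1 else 0) ∧ ∀ i j, h (w' i) (w' j) = 0 := by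
  obtain ⟨y, hy⟩ := exists_dual_family h hσ hnd bW
  have hσ2 : σ 2 = 2 := by rw [← one_add_one_eq_two, map_add, map_one]
  have hyw : ∀ i l, h (y i) (bW l) = if l = i then 1 else 0 := fun i l => by
    rw [hherm, hy]
    split_ifs <;> simp
  have hww : ∀ i l, h (bW i) (bW l) = 0 := fun i l => hWiso _ (bW i).2 _ (bW l).2
  refine ⟨fun j => y j - ∑ l, (h (y l) (y j) / 2) • (bW l : V), fun i j => ?_, fun i j => ?_⟩
  · beta_reduce
    rw [map_sub, apply_sum_smul_right, hy]
    simp [hww]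
  · beta_reduce
    rw [map_sub h, LinearMap.sub_apply, map_sub, map_sub, apply_sum_smul_right, apply_sum_smul_left,
      apply_sum_smul_left]
    simp only [hyw, hy, apply_sum_smul_right, hww, mul_ite, mul_one, mul_zero,
      Finset.sum_ite_eq', Finset.mem_univ, if_true, Finset.sum_const_zero, sub_zero]
    rw [map_div₀, hσ2, ← hherm]
    field_simp
    ring

omit [FiniteDimensional K V] in
/-- **The adapted basis of a hyperbolic frame.**  Let `W` be totally isotropic with basis `(w_i)`, `(w'_i)` hyperbolic partners
(`h(w_i, w'_j) = δ_{ij}`, `h(w'_i, w'_j) = 0`), `U` the common orthogonal `{v | h(w_i, v) = 0 = h(w'_i, v) ∀ i}` and `(u_j)` a basis of `U`.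
Then `(w, u, w')` is a basis of `V`, with coordinates `(v)_{w_i} = h(w'_i, v)`, `(v)_{w'_i} = h(w_i, v)`, and the `U`-coordinates of
`v` are those of `v − Σ h(w'_i, v) w_i − Σ h(w_i, v) w'_i ∈ U`. [folklore] -/
theorem exists_adapted_basis (hherm : ∀ x y, h y x = σ (h x y))
    {W : Submodule K V} (hWiso : ∀ x ∈ W, ∀ y ∈ W, h x y = 0) {ι : Type*} [Fintype ι] [DecidableEq ι] (bW : Basis ι K W)
    (w' : ι → V) (hww' : ∀ i j, h (bW i) (w' j) = if i = j then 1 else 0) (hw'w' : ∀ i j, h (w' i) (w' j) = 0)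
    {U : Submodule K V} (hU : ∀ v, v ∈ U ↔ (∀ i, h (bW i) v = 0) ∧ ∀ i, h (w' i) v = 0)
    {κ : Type*} [Fintype κ] [DecidableEq κ] (bU : Basis κ K U) :
    ∃ b : Basis (ι ⊕ (κ ⊕ ι)) K V,
      (∀ i, b (Sum.inl i) = bW i) ∧ (∀ j, b (Sum.inr (Sum.inl j)) = bU j) ∧ (∀ i, b (Sum.inr (Sum.inr i)) = w' i) ∧
      (∀ v i, b.repr v (Sum.inl i) = h (w' i) v) ∧ (∀ v i, b.repr v (Sum.inr (Sum.inr i)) = h (bW i) v) ∧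
      (∀ v, v - ∑ i, h (w' i) v • (bW i : V) - ∑ i, h (bW i) v • w' i ∈ U) ∧
      (∀ (v : V) (hv : v - ∑ i, h (w' i) v • (bW i : V) - ∑ i, h (bW i) v • w' i ∈ U) (j : κ),
        b.repr v (Sum.inr (Sum.inl j)) = bU.repr ⟨_, hv⟩ j) := by
  -- pairings of the frame
  have hw'w : ∀ i j, h (w' i) (bW j) = if j = i then 1 else 0 := fun i j => by
    rw [hherm, hww']; split_ifs <;> simp
  have hwu : ∀ i (u : U), h (bW i) u = 0 := fun i u => ((hU u).1 u.2).1 i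
  have hw'u : ∀ i (u : U), h (w' i) u = 0 := fun i u => ((hU u).1 u.2).2 i
  have hww : ∀ i j, h (bW i) (bW j) = 0 := fun i j => hWiso _ (bW i).2 _ (bW j).2
  -- the family
  let f : ι ⊕ (κ ⊕ ι) → V := Sum.elim (fun i => (bW i : V)) (Sum.elim (fun j => (bU j : V)) w')
  -- projection to `U`
  have hprU : ∀ v, v - ∑ i, h (w' i) v • (bW i : V) - ∑ i, h (bW i) v • w' i ∈ U := by
    intro v
    rw [hU]
    constructor
    · intro k
      rw [map_sub, map_sub, apply_sum_smul_right, apply_sum_smul_right]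
      simp [hww, hww', mul_ite]
    · intro k
      rw [map_sub, map_sub, apply_sum_smul_right, apply_sum_smul_right]
      simp [hw'w, hw'w', mul_ite]
  -- pairing a combination of the family with `w_i` and `w'_i`
  have hpair_w : ∀ (c : ι ⊕ (κ ⊕ ι) → K) i, h (bW i) (∑ k, c k • f k) = c (Sum.inr (Sum.inr i)) := by
    intro c i
    rw [apply_sum_smul_right, Fintype.sum_sum_type, Fintype.sum_sum_type]
    simp [f, hww, hwu, hww', mul_ite]
  have hpair_w' : ∀ (c : ι ⊕ (κ ⊕ ι) → K) i, h (w' i) (∑ k, c k • f k) = c (Sum.inl i) := by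
    intro c i
    rw [apply_sum_smul_right, Fintype.sum_sum_type, Fintype.sum_sum_type]
    simp [f, hw'w, hw'u, hw'w', mul_ite]
  -- linear independence
  have hli : LinearIndependent K f := by
    rw [Fintype.linearIndependent_iff]
    intro c hc k
    have hcw : ∀ i, c (Sum.inr (Sum.inr i)) = 0 := fun i => by rw [← hpair_w c i, hc, map_zero]
    have hcw' : ∀ i, c (Sum.inl i) = 0 := fun i => by rw [← hpair_w' c i, hc, map_zero]
    have hcu : ∀ j, c (Sum.inr (Sum.inl j)) = 0 := by
      have hsum : ∑ j, c (Sum.inr (Sum.inl j)) • (bU j : V) = 0 := by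
        rw [Fintype.sum_sum_type, Fintype.sum_sum_type] at hc
        simpa [f, hcw, hcw'] using hc
      have hsum' : ∑ j, c (Sum.inr (Sum.inl j)) • bU j = 0 := by
        apply Subtype.ext
        simpa using hsum
      exact fun j => Fintype.linearIndependent_iff.1 bU.linearIndependent _ hsum' j
    rcases k with i | j | i
    · exact hcw' i
    · exact hcu j
    · exact hcw i
  -- spanning
  have hsp : ⊤ ≤ Submodule.span K (Set.range f) := by
    intro v _
    have hu := hprU v
    set u : U := ⟨_, hu⟩ with hudef
    have hv : v = ∑ i, h (w' i) v • (bW i : V) + (u : V) + ∑ i, h (bW i) v • w' i := by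
      simp only [hudef]; abel
    rw [hv]
    refine Submodule.add_mem _ (Submodule.add_mem _ (Submodule.sum_mem _ fun i _ => ?_) ?_)
      (Submodule.sum_mem _ fun i _ => ?_)
    · exact Submodule.smul_mem _ _ (Submodule.subset_span ⟨Sum.inl i, rfl⟩)
    · rw [coe_eq_sum_repr bU u]
      exact Submodule.sum_mem _ fun j _ => Submodule.smul_mem _ _ (Submodule.subset_span ⟨Sum.inr (Sum.inl j), rfl⟩)
    · exact Submodule.smul_mem _ _ (Submodule.subset_span ⟨Sum.inr (Sum.inr i), rfl⟩)
  let b : Basis (ι ⊕ (κ ⊕ ι)) K V := Basis.mk hli hsp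
  have hb : ⇑b = f := Basis.coe_mk hli hsp
  -- coordinates
  have hcoord : ∀ (v : V) (hv : v - ∑ i, h (w' i) v • (bW i : V) - ∑ i, h (bW i) v • w' i ∈ U),
      ⇑(b.repr v) = Sum.elim (fun i => h (w' i) v) (Sum.elim (fun j => bU.repr ⟨_, hv⟩ j) (fun i => h (bW i) v)) := by
    intro v hv
    set c : ι ⊕ (κ ⊕ ι) → K := Sum.elim (fun i => h (w' i) v) (Sum.elim (fun j => bU.repr ⟨_, hv⟩ j) (fun i => h (bW i) v))
    have hv' : v = ∑ k, c k • b k := by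
      rw [hb, Fintype.sum_sum_type, Fintype.sum_sum_type]
      simp only [c, f, Sum.elim_inl, Sum.elim_inr]
      rw [← coe_eq_sum_repr bU ⟨_, hv⟩]
      simp only
      abel
    conv_lhs => rw [hv']
    exact b.repr_sum_self c
  refine ⟨b, fun i => by rw [hb]; rfl, fun j => by rw [hb]; rfl, fun i => by rw [hb]; rfl, fun v i => ?_, fun v i => ?_, hprU,
    fun v hv j => ?_⟩
  · rw [hcoord v (hprU v)]; rfl
  · rw [hcoord v (hprU v)]; rfl
  · rw [hcoord v hv]; rfl

end Summit.HodgeConjecture.HodgeConjecture.Cruxes.H413.K2E3OrbitClosureHermitianPairs
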